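import Literature.AnabelianGeometry.SemiGraphs.PSCCompactifiedLevelBridge
import HarnessLib

/-!
# [CombGC] Thm. 1.6 (ii), descent step (row T16-L09b-E4, NODES): the node correspondence of the
# compactified coverings `(G_U)'`, `(H_{U'})'` and the group-theoretic EDGE-LIKENESS of `α`

Mochizuki, *A combinatorial version of the Grothendieck conjecture*, Tohoku Math. J. **59** (2007) [CombGC],
proof of Theorem 1.6 (ii), author's ms p. 14 l.18–24: after replacing `G`, `H` by their compactifications,
"by Proposition 1.5, (ii), it suffices to prove that `α` is group-theoretically edge-like and
group-theoretically verticial.  But by Remark 1.4.4, the assumption that `α` is edge-wise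
filtration-preserving implies that `α` is group-theoretically edge-like" (render `paper:url-6994f81053dc`
p0014); Proposition 1.2 (i) p. 8. [cite: MochizukiCombGC2007, Thm 1.6(ii) p.14]

PROOF-ONLY companion of `PSCCompactifiedLevelBridge.lean` (p423150; abc-iut cell, layer L3,
`plan/L3/SUBDAG-CombGC-Thm16.md` row T16-L09b, holder abc-iut-w5-d188): the same bridge for the NODES.
The edge-like subgroups of a compactification are the images of the NODAL subgroups
(`isEdgeLike_compactifyAlong_iff`, p418457), so a graphic (or group-theoretically edge-like)
`ᾱ_U : Π_{(G_U)'} ≅ Π_{(H_{U'})'}` matches NODE classes; the cusps are handled by the group-theoretic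
cuspidality of `α` itself (Thm. 1.6 (i)).  Contents:
* `exists_inf_nrep_smul_eq`, `compactify_restrict_nodeGp` — node versions of the vertex lemmas;
* **`graphic_mod_of_nodeGraphic_compactify`** — the node clause of `IsGraphicVia` for `ᾱ_U` ⇒ the node
  bijection (re-indexed by double cosets) is `α`-graphic modulo `Ker(Π_{H_{U'}} ↠ Π^cpt)↑`;
* **`sep_mod_nodal_of_edgeLikeOpenInter_compactify`** — Prop. 1.2 (i) for `(H_{U'})'`
  (`EdgeLikeOpenInterDeterminesEdge`, at its nodes) ⇒ separation of the nodes of `H_{U'}` modulo `Ker'↑`;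
* **`graphic_mod_package_nodes`** — the level-`U` datum for `transport_of_graphic_mod` (p421678) with the
  nodal families; **`isGroupTheoreticallyEdgeLike_of_nodal_of_cuspidal`** — nodal classes corresponding
  under `α` plus `α` group-theoretically cuspidal ⇒ `α` group-theoretically edge-like; and the all-levels
  corollary **`nodal_transport_of_graphic_mod`**.
Pure plumbing over landed vocabulary; no definitions; nothing here takes a side on [IUTchIII] Cor. 3.12.
-/

noncomputable section

namespace Literature.AnabelianGeometry.SemiGraphs

namespace PSCDatum

open scoped Pointwise
open PSCCovering

universe u

variable {P : Type u} [Group P] [TopologicalSpace P]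
variable {P' : Type u} [Group P'] [TopologicalSpace P']

/-! ### 1. Nodal classes + cuspidality ⇒ edge-likeness; the all-levels nodal transport -/

/-- **Nodal classes corresponding under `α` plus group-theoretic cuspidality ⇒ `α` group-theoretically
edge-like** (edge-like = nodal ∨ cuspidal). [cite: MochizukiCombGC2007, Def 1.4(iv) p.11] -/
theorem isGroupTheoreticallyEdgeLike_of_nodal_of_cuspidal {G : PSCDatum P} {H : PSCDatum P'} {α : P ≃ₜ* P'}
    (hn₁ : ∀ A, G.IsNodal A → H.IsNodal (A.map α.toMulEquiv.toMonoidHom))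
    (hn₂ : ∀ B, H.IsNodal B → ∃ A, G.IsNodal A ∧ A.map α.toMulEquiv.toMonoidHom = B)
    (hc : G.IsGroupTheoreticallyCuspidal H α) : G.IsGroupTheoreticallyEdgeLike H α := by
  refine ⟨fun A hA => ?_, fun B hB => ?_⟩
  · rcases hA with hA | hA
    · exact Or.inl (hn₁ A hA)
    · exact Or.inr (hc.1 A hA)
  · rcases hB with hB | hB
    · obtain ⟨A, hA, hAB⟩ := hn₂ B hB
      exact ⟨A, Or.inl hA, hAB⟩
    · obtain ⟨A, hA, hAB⟩ := hc.2 B hB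
      exact ⟨A, Or.inr hA, hAB⟩

section AllLevels

variable [IsTopologicalGroup P] [CompactSpace P] [TotallyDisconnectedSpace P]
variable [IsTopologicalGroup P'] [CompactSpace P'] [TotallyDisconnectedSpace P']
variable (α : P ≃ₜ* P') (G : PSCDatum P) (H : PSCDatum P')

/-- **Level-wise `α`-graphic-mod-`K'_U` bijections of the NODE sets with separation ⇒ `α` carries nodal
classes to nodal classes and back** (`transport_of_graphic_mod` of p421678 with the nodal families).
[cite: MochizukiCombGC2007, Thm 1.6(ii) p.14] -/
theorem nodal_transport_of_graphic_mod
    (h : ∀ U : Subgroup P, U.Normal → IsOpen (U : Set P) →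
      ∃ (K' : Subgroup P') (_ : K'.Normal)
        (e : (Σ n, DoubleCoset.Quotient (U : Set P) (G.nodeGp n : Set P)) ≃
          (Σ m, DoubleCoset.Quotient ((U.map α.toMulEquiv.toMonoidHom : Subgroup P') : Set P')
            (H.nodeGp m : Set P'))),
        (∀ (n : G.graph.N) (x : P) (m : H.graph.N) (y : P'),
          e ⟨n, DoubleCoset.mk U (G.nodeGp n) x⟩ =
              ⟨m, DoubleCoset.mk (U.map α.toMulEquiv.toMonoidHom) (H.nodeGp m) y⟩ →
            ∃ u' ∈ U.map α.toMulEquiv.toMonoidHom,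
              (U ⊓ ConjAct.toConjAct x • G.nodeGp n).map α.toMulEquiv.toMonoidHom ⊔ K' =
                ConjAct.toConjAct u' •
                  ((U.map α.toMulEquiv.toMonoidHom ⊓ ConjAct.toConjAct y • H.nodeGp m) ⊔ K')) ∧
        (∀ (m₁ : H.graph.N) (y₁ : P') (m₂ : H.graph.N) (y₂ : P'),
          (∃ u' ∈ U.map α.toMulEquiv.toMonoidHom,
              (U.map α.toMulEquiv.toMonoidHom ⊓ ConjAct.toConjAct y₁ • H.nodeGp m₁) ⊔ K' =
                ConjAct.toConjAct u' •
                  ((U.map α.toMulEquiv.toMonoidHom ⊓ ConjAct.toConjAct y₂ • H.nodeGp m₂) ⊔ K')) →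
            (⟨m₁, DoubleCoset.mk (U.map α.toMulEquiv.toMonoidHom) (H.nodeGp m₁) y₁⟩ :
                Σ m, DoubleCoset.Quotient ((U.map α.toMulEquiv.toMonoidHom : Subgroup P') : Set P')
                  (H.nodeGp m : Set P')) =
              ⟨m₂, DoubleCoset.mk (U.map α.toMulEquiv.toMonoidHom) (H.nodeGp m₂) y₂⟩)) :
    (∀ A, G.IsNodal A → H.IsNodal (A.map α.toMulEquiv.toMonoidHom)) ∧
      ∀ B, H.IsNodal B → ∃ A, G.IsNodal A ∧ A.map α.toMulEquiv.toMonoidHom = B := by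
  obtain ⟨h₁, h₂⟩ := transport_of_graphic_mod α G.nodeGp G.isClosed_nodeGp H.nodeGp H.isClosed_nodeGp h
  exact ⟨fun A ⟨n, γ, hA⟩ => by obtain ⟨m, δ, h'⟩ := h₁ A ⟨n, γ, hA⟩; exact ⟨m, δ, h'⟩,
    fun B ⟨m, δ, hB⟩ => by
      obtain ⟨A, ⟨n, γ, hA⟩, hAB⟩ := h₂ B ⟨m, δ, hB⟩; exact ⟨A, ⟨n, γ, hA⟩, hAB⟩⟩

end AllLevels

/-! ### 2. Reading the nodal hypotheses off the compactified coverings -/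

section Level

variable [IsTopologicalGroup P] [IsTopologicalGroup P']
variable (G : PSCDatum P) (H : PSCDatum P') (α : P ≃ₜ* P')
variable (U : Subgroup P) [U.FiniteIndex] [U.Normal] (hU : IsOpen (U : Set P))
variable (U' : Subgroup P') [U'.FiniteIndex] [U'.Normal] (hU' : IsOpen (U' : Set P'))

omit [IsTopologicalGroup P] in
/-- The representative nodal group of the node of `G_U` through `x` over `n` is a `U`-conjugate of
`U ⊓ Π_n^x`. [cite: MochizukiCombGC2007, Def 1.1(ii) p.7] -/
theorem exists_inf_nrep_smul_eq (n : G.graph.N) (x : P) :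
    ∃ u ∈ U, U ⊓ ConjAct.toConjAct (G.nrep U ⟨n, dcIdx U (G.nodeGp n) x⟩) • G.nodeGp n =
      ConjAct.toConjAct u • (U ⊓ ConjAct.toConjAct x • G.nodeGp n) := by
  obtain ⟨u, hu, k, hk, hrep⟩ := exists_dcRep_dcIdx_eq U (G.nodeGp n) x
  refine ⟨u, hu, ?_⟩
  change U ⊓ ConjAct.toConjAct (dcRep U (G.nodeGp n) (dcIdx U (G.nodeGp n) x)) • G.nodeGp n = _
  rw [hrep, conjAct_smul_inf_of_normal inferInstance, map_mul, mul_smul, map_mul, mul_smul,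
    Subgroup.conjAct_pointwise_smul_eq_self (Subgroup.le_normalizer hk)]

variable [CompactSpace U] [CompactSpace U']
variable [(G.restrict U hU).cptKer.Normal] [(H.restrict U' hU').cptKer.Normal]

omit [U.Normal] in
/-- The nodal groups of the compactified covering `(G_U)'` are the images of those of `G_U`.
[cite: MochizukiCombGC2007, Rmk 1.1.6 p.8] -/
theorem compactify_restrict_nodeGp (X : (G.restrictGraph U).N) :
    (G.restrict U hU).compactify.nodeGp X =
      ((G.restrict U hU).nodeGp X).map (QuotientGroup.mk' (G.restrict U hU).cptKer) := rfl

/-- **Nodes: the "graphic modulo `Ker(↠ Π^cpt)`" clause READ OFF the compactified coverings.**  From the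
NODE clause of `IsGraphicVia` for `ᾱ : Π_{(G_U)'} ≅ Π_{(H_{U'})'}` over `α|_U` along a bijection `ι` of the
node sets: for nodes `U x Π_n ↦ U' y Π_m` corresponding under `ι`, `α(U ⊓ Π_n^x) · Ker'↑` is a
`U'`-conjugate of `(U' ⊓ Π_m^y) · Ker'↑`. [cite: MochizukiCombGC2007, Thm 1.6(ii) p.14] -/
theorem graphic_mod_of_nodeGraphic_compactify (hUU' : U.map α.toMulEquiv.toMonoidHom = U')
    (αU : U ≃ₜ* U') (hαU : ∀ u : U, ((αU u : U') : P') = α u)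
    (ᾱ : (U ⧸ (G.restrict U hU).cptKer) ≃ₜ* (U' ⧸ (H.restrict U' hU').cptKer))
    (hᾱ : ∀ u : U, ᾱ (QuotientGroup.mk' (G.restrict U hU).cptKer u) =
      QuotientGroup.mk' (H.restrict U' hU').cptKer (αU u))
    (ι : (G.restrictGraph U).N ≃ (H.restrictGraph U').N)
    (hι : ∀ X : (G.restrictGraph U).N, ∃ γ : ConjAct (U' ⧸ (H.restrict U' hU').cptKer),
      ((G.restrict U hU).compactify.nodeGp X).map ᾱ.toMulEquiv.toMonoidHom =
        γ • (H.restrict U' hU').compactify.nodeGp (ι X))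
    {n : G.graph.N} {x : P} {m : H.graph.N} {y : P'}
    (hxy : ι ⟨n, dcIdx U (G.nodeGp n) x⟩ = ⟨m, dcIdx U' (H.nodeGp m) y⟩) :
    ∃ u' ∈ U', (U ⊓ ConjAct.toConjAct x • G.nodeGp n).map α.toMulEquiv.toMonoidHom ⊔
        (H.restrict U' hU').cptKer.map U'.subtype =
      ConjAct.toConjAct u' • ((U' ⊓ ConjAct.toConjAct y • H.nodeGp m) ⊔
        (H.restrict U' hU').cptKer.map U'.subtype) := by
  have hK'n : ((H.restrict U' hU').cptKer.map U'.subtype).Normal := H.map_subtype_cptKer_normal U' hU'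
  obtain ⟨γ, hγ⟩ := hι ⟨n, dcIdx U (G.nodeGp n) x⟩
  rw [hxy, compactify_restrict_nodeGp, compactify_restrict_nodeGp] at hγ
  obtain ⟨u₀, hu₀⟩ : ∃ u₀ : U', ConjAct.toConjAct (QuotientGroup.mk' (H.restrict U' hU').cptKer u₀) = γ := by
    obtain ⟨u₀, hu₀⟩ := QuotientGroup.mk'_surjective (H.restrict U' hU').cptKer (ConjAct.ofConjAct γ)
    exact ⟨u₀, by rw [hu₀, ConjAct.toConjAct_ofConjAct]⟩
  rw [← hu₀] at hγ
  have hpull := congrArg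
    (fun Z : Subgroup (U' ⧸ (H.restrict U' hU').cptKer) =>
      (Z.comap (QuotientGroup.mk' (H.restrict U' hU').cptKer)).map U'.subtype) hγ
  rw [pullback_map_map α αU hαU ᾱ hᾱ, pullback_conj, restrict_nodeGp_map, restrict_nodeGp,
    pullback_map_subgroupOf] at hpull
  obtain ⟨u₁, hu₁, h₁⟩ := G.exists_inf_nrep_smul_eq U n x
  obtain ⟨u₂, hu₂, h₂⟩ := H.exists_inf_nrep_smul_eq U' m y
  change (U ⊓ ConjAct.toConjAct (G.nrep U ⟨n, dcIdx U (G.nodeGp n) x⟩) • G.nodeGp n).map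
      α.toMulEquiv.toMonoidHom ⊔ _ = ConjAct.toConjAct (u₀ : P') •
      ((U' ⊓ ConjAct.toConjAct (H.nrep U' ⟨m, dcIdx U' (H.nodeGp m) y⟩) • H.nodeGp m) ⊔ _) at hpull
  rw [h₁, h₂, map_conj_smul, ← conjAct_smul_sup_of_normal hK'n, ← conjAct_smul_sup_of_normal hK'n,
    ← mul_smul] at hpull
  have hαu₁ : α u₁ ∈ U' := by
    rw [← hUU']; exact ⟨u₁, hu₁, rfl⟩
  refine ⟨(α u₁)⁻¹ * ((u₀ : P') * u₂), U'.mul_mem (U'.inv_mem hαu₁) (U'.mul_mem u₀.2 hu₂), ?_⟩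
  have e1 : ConjAct.toConjAct (α.toMulEquiv.toMonoidHom (ConjAct.ofConjAct (ConjAct.toConjAct u₁))) =
      ConjAct.toConjAct (α u₁) := rfl
  rw [e1, ← map_mul] at hpull
  rw [map_mul, map_inv, mul_smul, eq_inv_smul_iff, hpull]

/-- **Nodes: SEPARATION modulo `Ker(↠ Π^cpt)` READ OFF Prop. 1.2 (i) for `(H_{U'})'`** (its
`EdgeLikeOpenInterDeterminesEdge`, used at the nodes, BY NAME): if the level-`U'` groups
`(U' ⊓ Π_{m₁}^{y₁}) · Ker'↑`, `(U' ⊓ Π_{m₂}^{y₂}) · Ker'↑` are `U'`-conjugate, the nodes `U' y₁ Π_{m₁}`,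
`U' y₂ Π_{m₂}` of `H_{U'}` coincide. [cite: MochizukiCombGC2007, Prop 1.2(i) p.8] -/
theorem sep_mod_nodal_of_edgeLikeOpenInter_compactify
    (hE : ((H.restrict U' hU').compactify).EdgeLikeOpenInterDeterminesEdge)
    {m₁ : H.graph.N} {y₁ : P'} {m₂ : H.graph.N} {y₂ : P'}
    (h : ∃ u' ∈ U', (U' ⊓ ConjAct.toConjAct y₁ • H.nodeGp m₁) ⊔ (H.restrict U' hU').cptKer.map U'.subtype =
      ConjAct.toConjAct u' • ((U' ⊓ ConjAct.toConjAct y₂ • H.nodeGp m₂) ⊔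
        (H.restrict U' hU').cptKer.map U'.subtype)) :
    (⟨m₁, DoubleCoset.mk U' (H.nodeGp m₁) y₁⟩ :
        Σ m, DoubleCoset.Quotient (U' : Set P') (H.nodeGp m : Set P')) =
      ⟨m₂, DoubleCoset.mk U' (H.nodeGp m₂) y₂⟩ := by
  have hK'n : ((H.restrict U' hU').cptKer.map U'.subtype).Normal := H.map_subtype_cptKer_normal U' hU'
  obtain ⟨u', hu', h⟩ := h
  obtain ⟨u₁, hu₁, h₁⟩ := H.exists_inf_nrep_smul_eq U' m₁ y₁
  obtain ⟨u₂, hu₂, h₂⟩ := H.exists_inf_nrep_smul_eq U' m₂ y₂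
  have hP : ∀ X : (H.restrictGraph U').N,
      ((((H.restrict U' hU').compactify.nodeGp X).comap
        (QuotientGroup.mk' (H.restrict U' hU').cptKer)).map U'.subtype) =
        (U' ⊓ ConjAct.toConjAct (H.nrep U' X) • H.nodeGp X.1) ⊔
          (H.restrict U' hU').cptKer.map U'.subtype := by
    intro X
    rw [compactify_restrict_nodeGp, restrict_nodeGp, pullback_map_subgroupOf]
  have hgU' : u₁ * u' * u₂⁻¹ ∈ U' := U'.mul_mem (U'.mul_mem hu₁ hu') (U'.inv_mem hu₂)
  have hrel : ((((H.restrict U' hU').compactify.nodeGp ⟨m₁, dcIdx U' (H.nodeGp m₁) y₁⟩).comap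
        (QuotientGroup.mk' (H.restrict U' hU').cptKer)).map U'.subtype) =
      (((ConjAct.toConjAct (QuotientGroup.mk' (H.restrict U' hU').cptKer ⟨u₁ * u' * u₂⁻¹, hgU'⟩) •
        (H.restrict U' hU').compactify.nodeGp ⟨m₂, dcIdx U' (H.nodeGp m₂) y₂⟩).comap
          (QuotientGroup.mk' (H.restrict U' hU').cptKer)).map U'.subtype) := by
    rw [pullback_conj, hP, hP]
    change (U' ⊓ ConjAct.toConjAct (H.nrep U' ⟨m₁, dcIdx U' (H.nodeGp m₁) y₁⟩) • H.nodeGp m₁) ⊔ _ =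
      ConjAct.toConjAct (u₁ * u' * u₂⁻¹) •
        ((U' ⊓ ConjAct.toConjAct (H.nrep U' ⟨m₂, dcIdx U' (H.nodeGp m₂) y₂⟩) • H.nodeGp m₂) ⊔ _)
    rw [h₁, h₂, ← conjAct_smul_sup_of_normal hK'n, h, ← conjAct_smul_sup_of_normal hK'n, ← mul_smul,
      ← mul_smul, ← map_mul, ← map_mul]
    congr 2
    group
  have heq := pullback_injective U' _ hrel
  have hX : (Sum.inl ⟨m₁, dcIdx U' (H.nodeGp m₁) y₁⟩ :
      (H.restrictGraph U').N ⊕ (H.restrictGraph U').compactify.C) =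
        Sum.inl ⟨m₂, dcIdx U' (H.nodeGp m₂) y₂⟩ := by
    refine hE _ _ 1
      (ConjAct.toConjAct (QuotientGroup.mk' (H.restrict U' hU').cptKer ⟨u₁ * u' * u₂⁻¹, hgU'⟩)) ?_
    exact isOpen_subgroupOf_inf_of_eq (by rw [one_smul]; exact heq)
  have hX' := Sum.inl_injective hX
  have hw : m₁ = m₂ := congrArg Sigma.fst hX'
  subst hw
  have hidx : dcIdx U' (H.nodeGp m₁) y₁ = dcIdx U' (H.nodeGp m₁) y₂ := eq_of_heq (Sigma.mk.inj_iff.mp hX').2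
  have hmk : DoubleCoset.mk U' (H.nodeGp m₁) y₁ = DoubleCoset.mk U' (H.nodeGp m₁) y₂ :=
    (dcEnum U' (H.nodeGp m₁)).injective hidx
  rw [hmk]

/-- **Nodes, PACKAGED: one level of the nodal descent** — the level-`U` datum for
`nodal_transport_of_graphic_mod` / `transport_of_graphic_mod` (p421678) from the node clause of a
graphic `ᾱ_U` between the compactified coverings and Prop. 1.2 (i) for `(H_{U'})'`.
[cite: MochizukiCombGC2007, Thm 1.6(ii) p.14] -/
theorem graphic_mod_package_nodes (hUU' : U.map α.toMulEquiv.toMonoidHom = U')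
    (αU : U ≃ₜ* U') (hαU : ∀ u : U, ((αU u : U') : P') = α u)
    (ᾱ : (U ⧸ (G.restrict U hU).cptKer) ≃ₜ* (U' ⧸ (H.restrict U' hU').cptKer))
    (hᾱ : ∀ u : U, ᾱ (QuotientGroup.mk' (G.restrict U hU).cptKer u) =
      QuotientGroup.mk' (H.restrict U' hU').cptKer (αU u))
    (ι : (G.restrictGraph U).N ≃ (H.restrictGraph U').N)
    (hι : ∀ X : (G.restrictGraph U).N, ∃ γ : ConjAct (U' ⧸ (H.restrict U' hU').cptKer),
      ((G.restrict U hU).compactify.nodeGp X).map ᾱ.toMulEquiv.toMonoidHom =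
        γ • (H.restrict U' hU').compactify.nodeGp (ι X))
    (hE : ((H.restrict U' hU').compactify).EdgeLikeOpenInterDeterminesEdge) :
    ∃ (K' : Subgroup P') (_ : K'.Normal)
      (e : (Σ n, DoubleCoset.Quotient (U : Set P) (G.nodeGp n : Set P)) ≃
        (Σ m, DoubleCoset.Quotient (U' : Set P') (H.nodeGp m : Set P'))),
      (∀ (n : G.graph.N) (x : P) (m : H.graph.N) (y : P'),
        e ⟨n, DoubleCoset.mk U (G.nodeGp n) x⟩ = ⟨m, DoubleCoset.mk U' (H.nodeGp m) y⟩ →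
          ∃ u' ∈ U', (U ⊓ ConjAct.toConjAct x • G.nodeGp n).map α.toMulEquiv.toMonoidHom ⊔ K' =
            ConjAct.toConjAct u' • ((U' ⊓ ConjAct.toConjAct y • H.nodeGp m) ⊔ K')) ∧
      (∀ (m₁ : H.graph.N) (y₁ : P') (m₂ : H.graph.N) (y₂ : P'),
        (∃ u' ∈ U', (U' ⊓ ConjAct.toConjAct y₁ • H.nodeGp m₁) ⊔ K' =
            ConjAct.toConjAct u' • ((U' ⊓ ConjAct.toConjAct y₂ • H.nodeGp m₂) ⊔ K')) →
          (⟨m₁, DoubleCoset.mk U' (H.nodeGp m₁) y₁⟩ :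
              Σ m, DoubleCoset.Quotient (U' : Set P') (H.nodeGp m : Set P')) =
            ⟨m₂, DoubleCoset.mk U' (H.nodeGp m₂) y₂⟩) := by
  refine ⟨(H.restrict U' hU').cptKer.map U'.subtype, H.map_subtype_cptKer_normal U' hU',
    (Equiv.sigmaCongrRight fun n => dcEnum U (G.nodeGp n)).trans
      (ι.trans (Equiv.sigmaCongrRight fun m => (dcEnum U' (H.nodeGp m)).symm)), ?_, ?_⟩
  · intro n x m y hexy
    rcases hιX : ι ⟨n, dcIdx U (G.nodeGp n) x⟩ with ⟨m', j⟩
    have hexy' : (⟨m', (dcEnum U' (H.nodeGp m')).symm j⟩ :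
        Σ m, DoubleCoset.Quotient (U' : Set P') (H.nodeGp m : Set P')) =
        ⟨m, DoubleCoset.mk U' (H.nodeGp m) y⟩ := by
      rw [← hexy]
      simp only [Equiv.trans_apply, Equiv.sigmaCongrRight_apply]
      change _ = (⟨(ι ⟨n, dcIdx U (G.nodeGp n) x⟩).1,
        (dcEnum U' (H.nodeGp (ι ⟨n, dcIdx U (G.nodeGp n) x⟩).1)).symm (ι ⟨n, dcIdx U (G.nodeGp n) x⟩).2⟩ :
          Σ m, DoubleCoset.Quotient (U' : Set P') (H.nodeGp m : Set P'))
      rw [hιX]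
    have hm : m' = m := congrArg Sigma.fst hexy'
    subst hm
    have hj : (dcEnum U' (H.nodeGp m')).symm j = DoubleCoset.mk U' (H.nodeGp m') y :=
      eq_of_heq (Sigma.mk.inj_iff.mp hexy').2
    have hj' : j = dcIdx U' (H.nodeGp m') y := by
      rw [Equiv.symm_apply_eq] at hj
      exact hj
    rw [hj'] at hιX
    exact graphic_mod_of_nodeGraphic_compactify G H α U hU U' hU' hUU' αU hαU ᾱ hᾱ ι hι hιX
  · intro m₁ y₁ m₂ y₂ h
    exact sep_mod_nodal_of_edgeLikeOpenInter_compactify H U' hU' hE h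

end Level

end PSCDatum

end Literature.AnabelianGeometry.SemiGraphs
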